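import Summits.HubbardSuperconductivity.HubbardLadder.Bounds.SpinCorrelationEtaLineEuclid
import Literature.MathematicalPhysics.QuantumLattice.HubbardInteractionClassSpinDecaySharp
import Mathlib.Order.LiminfLimsup
import HarnessLib
import HarnessLib.Audit

/-!
# Hubbard ladder — Bounds: the sharp MAGNETIC Koma–Tasaki ceilings are UNIFORM over the
# interaction class `H_Λ(t,U) - μN + V({n_{x,σ}})`, `V` any real function of the occupations
# (bounds.tex Thm 10⁷ (e); Koma–Tasaki eq. (1), last paragraph of the proof)

HONEST FRAMING (cell pub-hubbard): ladder R1–R4 with certified numbers; no claim on H/H₀. These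
are bounds for a MODEL CLASS — no materials claim. The class: the grand-canonical Hubbard
Hamiltonian `hubbardTorusWith d L t U μ` (all real `t, U, μ`) PLUS `densityInteraction W`, an
ARBITRARY real function `W` of the occupation numbers `{n_{x,σ}}` (extended / long-range /
screened-Coulomb / random density–density interactions of either sign, site potentials, and —
specific to the magnetic sector — arbitrary, e.g. random or staggered, LONGITUDINAL fields
`∑_u h_u S^z_u`). Koma–Tasaki state their theorem, magnetic clause included, for this class
(their eq. (1), "`V({n_{x,σ}})` an arbitrary function of the number operators"); the magnetic
bound comes from the spin-dependent sign gauge `θ_{x↑} = -θ_{x↓} = iψ_x`, which is again a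
function of the number operators and therefore commutes with every such `V`.

What this file files (all PROVED, `_holds`), with constants that do NOT depend on `W`:

* `ClassSpinEtaLineEuclid` — square lattice `(ℤ/Lℤ)²`, `β > 0`, `β|t| < 4/π`: ONE pair `f > 1/4`,
  `C` such that `|⟨S⁺_x S⁻_y⟩_{β,L; H+V}| ≤ C (dist(x,y)+1)^{-f}` for ALL `L`, ALL real `W`, all
  `x, y` — above `T = (π/4)|t|` the transverse spin correlations of every member of the class
  decay faster than the Kosterlitz–Thouless borderline `|x|^{-1/4}`.
* `ClassSpinEtaLineSharp` — the thermodynamic-limit form of the sharp exponent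
  `η_spin(T) ≥ T/(π|t|)`: for `ε > 0` ONE radius `R` such that for EVERY sequence of real
  functions `W_L` and every `z ∈ ℤ²` with `|z| ≥ R`,
  `limsup_{L→∞} |⟨S⁺_0 S⁻_z⟩_{β,L+1; H+V_L}| ≤ |z|^{-(1-ε)/(πβ|t|)}`.
* `ClassRingSpinCorrelationLengthLowT` / `ClassRingSpinCorrelationLengthHighT` — the ring `ℤ/Lℤ`:
  `|⟨S⁺_x S⁻_y⟩_{β,L; H+V}| ≤ e^{1/(β|t|)} exp(-dist/(4β|t|))` for `T ≤ 4|t|` (`ξ_spin(T) ≤ 4|t|/T`),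
  and `≤ e⁴ exp(-dist)` for `T ≥ 4|t|`, for ALL real `W`.

Reading: no density interaction of any range, sign or randomness, and no longitudinal field
configuration, can raise the temperature scale of the Koma–Tasaki magnetic ceilings in `d ≤ 2`;
it is set by the HOPPING alone (companion of the charge-sector statement
`Bounds/InteractionClassEtaLine.lean`, LEAN FILING REQUEST #152, IN TREE p236088).

Relation to what the tree already has: the `W = 0` members are the nodes `SpinEtaLineEuclid`,
`SpinEtaLineSharp` (`Bounds/SpinCorrelationEtaLineEuclid.lean`, p228764) and the ring rows
`RingSpinCorrelationLengthLowT` / `RingSpinCorrelationLengthHighT`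
(`Bounds/RingSpinExponentialClustering.lean`, p235900), and the tree's `koma_tasaki_magnetic_holds`
(qualitative, `W = 0`); this file does not re-file them — its content is the uniformity in `W`
(`densityInteraction_zero` recovers the `W = 0` rows: `spinRing_lowT_of_class`). Mechanism
(Literature `HubbardInteractionClassSpinDecaySharp`, p235739, this seat): the a priori bound
`norm_thermalCorr_siteSpinPlus_densityInteraction_le_sharp` carries the printed hopping norm and no
`W`; the profile steps (`le_rpow_euclid_of_apriori_flat`, `le_exp_ring_of_apriori_flat`) consume
only that bound.

NOT claimed: optimality of any constant; perturbations that do not commute with the spin-resolved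
densities `n_{uσ}` (transverse fields, exchange couplings, charge-moving terms); `⟨S^zS^z⟩`; `T = 0`.

References (keys of `lean/references.bib`): KomaTasakiPRL1992 (eq. (1) and the paragraph after
it; eqs. (5)–(13); Theorem eq. (4), both clauses; last paragraph of the proof);
McBryanSpencer1977. Companion text: `pub-hubbard/paper/bounds.tex` Thm 10⁷ (e); table
`pub-hubbard-bounds/BOUNDS.md` (row T8¹³); `pub-hubbard-bounds/EXTREMISERS.md` §5n.
-/

noncomputable section

namespace Summit.HubbardSuperconductivity.HubbardLadder.Bounds

open Matrix Finset NormedSpace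
open Literature.MathematicalPhysics.QuantumLattice Literature.Probability.LatticeModels
  Literature.Barriers.HubbardSuperconductivity
open scoped Matrix.Norms.L2Operator ComplexOrder

/-! ### Square lattice: the magnetic `η = 1/4` line, uniformly over the class -/

/-- **Thm 10⁷ (e), torus form (PROVED below).** On `(ℤ/Lℤ)²`, for all real `t, U, μ`, every
`β > 0` with `β|t| < 4/π` (`T > (π/4)|t|`) there are `f > 1/4` and `C` — depending on `β|t|`
ONLY — such that for every `L`, every real function `W` of the occupation numbers and all
`x, y`: `|⟨S⁺_x S⁻_y⟩_{β,L; H(t,U)-μN+V_W}| ≤ C (dist(x,y)+1)^{-f}`. kind: support (PROVED). Why it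
might fail: it cannot (proved); NOT claimed: perturbations not commuting with the `n_{uσ}`,
optimality. Sources: KomaTasakiPRL1992 eq. (1) (the class), Theorem eq. (4), eqs. (5)–(13), last
paragraph of the proof; McBryanSpencer1977; this cell bounds.tex Thm 10⁷ (e); tree node
`SpinEtaLineEuclid` (the member `W = 0`). -/
@[conjecture] def ClassSpinEtaLineEuclid : Prop :=
  ∀ (t U μ β : ℝ), 0 < β → β * |t| < 4 / Real.pi →
    ∃ f C : ℝ, 1 / 4 < f ∧ ∀ (L : ℕ) [NeZero L] (W : Finset (Orb (FermionTorus 2 L)) → ℝ)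
      (x y : TorusSite 2 L),
      ‖(hubbardTorusWith 2 L t U μ + densityInteraction W).thermalCorr β
          (siteSpinPlus x) (siteSpinPlus y)ᴴ‖ ≤
        C * ((torusDist x y : ℝ) + 1) ^ (-f)

/-- **`ClassSpinEtaLineEuclid` holds** (witness `q = 1/4` when `πβ|t| ≤ 2`, `f = 1 - πβ|t|/4 ≥ 1/2`;
else `q = 1/(2πβ|t|)`, `f = 1/(πβ|t|) > 1/4`; `C = K(q) 5^f` is free of `W`). -/
theorem classSpinEtaLineEuclid_holds : ClassSpinEtaLineEuclid := by
  intro t U μ β hβ hb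
  have hβt : 0 ≤ β * |t| := mul_nonneg hβ.le (abs_nonneg t)
  have hπ := Real.pi_pos
  have hb4 : Real.pi * (β * |t|) < 4 := by
    have := (lt_div_iff₀ hπ).1 hb
    linarith
  by_cases hc : Real.pi * (β * |t|) ≤ 2
  · -- `q = 1/4`
    have hf0 : 0 ≤ 4 * (1 / 4 : ℝ) - 4 * Real.pi * (β * |t|) * (1 / 4 : ℝ) ^ 2 := by
      nlinarith
    refine ⟨4 * (1 / 4 : ℝ) - 4 * Real.pi * (β * |t|) * (1 / 4 : ℝ) ^ 2,
      Real.exp (2 * (β * |t|) * (2 * Real.pi * (1 / 4 : ℝ) ^ 2 + 76 * (1 / 4 : ℝ) ^ 2 +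
        544 * (1 / 4 : ℝ) ^ 4 * Real.exp (2 * (1 / 4 : ℝ) ^ 2))) *
        (5 : ℝ) ^ (4 * (1 / 4 : ℝ) - 4 * Real.pi * (β * |t|) * (1 / 4 : ℝ) ^ 2),
      by nlinarith, fun L _ W x y => ?_⟩
    rw [mul_assoc]
    exact norm_thermalCorr_siteSpinPlus_densityInteraction_le_rpow_euclid L t U μ β (1 / 4) hβ.le
      (by norm_num) hf0 W x y
  · -- `q = q* = 1/(2πβ|t|)`
    have hc' : 2 < Real.pi * (β * |t|) := not_le.1 hc
    have hb0 : 0 < β * |t| := by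
      rcases hβt.eq_or_lt with h | h
      · rw [← h, mul_zero] at hc'; linarith
      · exact h
    set q : ℝ := 1 / (2 * Real.pi * (β * |t|)) with hq
    have hq0 : 0 ≤ q := by positivity
    have hfval : 4 * q - 4 * Real.pi * (β * |t|) * q ^ 2 = 1 / (Real.pi * (β * |t|)) := by
      rw [hq]
      field_simp
      ring
    have hf4 : 1 / 4 < 4 * q - 4 * Real.pi * (β * |t|) * q ^ 2 := by
      rw [hfval, div_lt_div_iff₀ (by norm_num) (by positivity)]
      linarith
    refine ⟨4 * q - 4 * Real.pi * (β * |t|) * q ^ 2,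
      Real.exp (2 * (β * |t|) * (2 * Real.pi * q ^ 2 + 76 * q ^ 2 +
        544 * q ^ 4 * Real.exp (2 * q ^ 2))) *
        (5 : ℝ) ^ (4 * q - 4 * Real.pi * (β * |t|) * q ^ 2), hf4, fun L _ W x y => ?_⟩
    rw [mul_assoc]
    exact norm_thermalCorr_siteSpinPlus_densityInteraction_le_rpow_euclid L t U μ β q hβ.le hq0
      (by linarith) W x y

/-! ### Square lattice: the sharp magnetic exponent in the thermodynamic limit, uniformly -/

/-- **Thm 10⁷ (e), thermodynamic-limit form (PROVED below).** For all real `U, μ`, `t ≠ 0`,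
`β > 0` and `ε > 0` there is a radius `R` — depending on `β|t|, ε` ONLY — such that for EVERY
sequence `W_L` of real functions of the occupation numbers of `(ℤ/(L+1)ℤ)²` and every `z ∈ ℤ²`
with `|z| ≥ R`: `limsup_{L→∞} |⟨S⁺_0 S⁻_z⟩_{β,L+1; H(t,U)-μN+V_{W_L}}| ≤ |z|^{-(1-ε)/(πβ|t|)}` — the
sharp Koma–Tasaki magnetic exponent `η_spin(T) = T/(π|t|)` for the whole class. kind: support
(PROVED). Why it might fail: it cannot (proved). Sources: KomaTasakiPRL1992 eq. (1), Theorem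
eq. (4), last paragraph of the proof; McBryanSpencer1977; this cell bounds.tex Thm 10⁷ (e);
tree node `SpinEtaLineSharp` (the member `W = 0`). -/
@[conjecture] def ClassSpinEtaLineSharp : Prop :=
  ∀ (t U μ β : ℝ), 0 < |t| → 0 < β → ∀ ε : ℝ, 0 < ε →
    ∃ R : ℝ,
      ∀ (W : (L : ℕ) → Finset (Orb (FermionTorus 2 (L + 1))) → ℝ) (z : Fin 2 → ℤ),
        R ≤ intNorm z →
          Filter.limsup (fun L : ℕ =>
              ‖(hubbardTorusWith 2 (L + 1) t U μ + densityInteraction (W L)).thermalCorr β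
                (siteSpinPlus (torusSiteOfInt (L + 1) 0))
                (siteSpinPlus (torusSiteOfInt (L + 1) z))ᴴ‖)
            Filter.atTop ≤ intNorm z ^ (-((1 - ε) / (Real.pi * β * |t|)))

/-- **`ClassSpinEtaLineSharp` holds.** The radius `R` is produced by `exists_limsup_le_rpow`
applied to the (`W`-free) BOUND `K(q*) 5^{f*} (dist+1)^{-f*}` itself, `q* = 1/(2πβ|t|)`,
`f* = 1/(πβ|t|)`; for each sequence `W_L` the correlator is dominated by that bound
(`norm_thermalCorr_siteSpinPlus_densityInteraction_le_rpow_euclid`), so its `limsup` is too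
(`Filter.limsup_le_limsup`). -/
theorem classSpinEtaLineSharp_holds : ClassSpinEtaLineSharp := by
  intro t U μ β ht hβ ε hε
  set b : ℝ := β * |t| with hbdef
  have hb0 : 0 < b := mul_pos hβ ht
  have hπ := Real.pi_pos
  set q : ℝ := 1 / (2 * Real.pi * b) with hq
  have hq0 : 0 ≤ q := by positivity
  set fs : ℝ := 4 * q - 4 * Real.pi * b * q ^ 2 with hfs
  have hfval : fs = 1 / (Real.pi * b) := by
    rw [hfs, hq]
    field_simp
    ring
  have hfpos : 0 < fs := by rw [hfval]; positivity
  have hεf : 0 < ε * fs := by positivity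
  set K : ℝ := Real.exp (2 * b *
    (2 * Real.pi * q ^ 2 + 76 * q ^ 2 + 544 * q ^ 4 * Real.exp (2 * q ^ 2))) with hK
  have hK0 : 0 < K := Real.exp_pos _
  -- the `W`-free majorant
  set G : ℕ → (Fin 2 → ℤ) → ℝ := fun L z => K * ((5 : ℝ) ^ fs *
    ((torusDist (torusSiteOfInt (L + 1) 0) (torusSiteOfInt (L + 1) z) : ℝ) + 1) ^ (-fs)) with hG
  have hG0 : ∀ L z, 0 ≤ G L z := fun L z => by
    simp only [hG]
    exact mul_nonneg hK0.le (mul_nonneg (Real.rpow_nonneg (by norm_num) _)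
      (Real.rpow_nonneg (by positivity) _))
  have hGle : ∀ L z, G L z ≤ K * (5 : ℝ) ^ fs := fun L z => by
    simp only [hG]
    rw [← mul_assoc]
    refine mul_le_of_le_one_right (by positivity) ?_
    exact Real.rpow_le_one_of_one_le_of_nonpos (by simp) (by linarith)
  obtain ⟨R, hR⟩ := exists_limsup_le_rpow G K fs (ε * fs) hK0 hfpos hεf hG0 (fun L z => le_rfl)
  refine ⟨R, fun W z hz => ?_⟩
  have hexp : -((1 - ε) / (Real.pi * β * |t|)) = -fs + ε * fs := by
    rw [hfval, hbdef]
    field_simp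
    ring
  rw [hexp]
  refine le_trans ?_ (hR z hz)
  refine Filter.limsup_le_limsup (Filter.Eventually.of_forall fun L => ?_)
    (Filter.isCoboundedUnder_le_of_le _ (fun L => norm_nonneg _))
    (Filter.isBoundedUnder_of_eventually_le (a := K * (5 : ℝ) ^ fs)
      (Filter.Eventually.of_forall fun L => hGle L z))
  exact norm_thermalCorr_siteSpinPlus_densityInteraction_le_rpow_euclid (L + 1) t U μ β q hβ.le
    hq0 hfpos.le (W L) (torusSiteOfInt (L + 1) 0) (torusSiteOfInt (L + 1) z)

/-! ### The ring: explicit transverse spin correlation lengths, uniformly over the class -/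

/-- **Thm 10⁷ (e), ring, low temperature (PROVED below).** On the ring `ℤ/Lℤ`, for all real
`t, U, μ`, `β ≥ 0` with `1 ≤ 4β|t|` (`T ≤ 4|t|`), every `L`, every real function `W` of the
occupation numbers and all `x, y`:
`|⟨S⁺_x S⁻_y⟩_{β,L; H(t,U)-μN+V_W}| ≤ e^{1/(β|t|)} exp(-dist(x,y)/(4β|t|))` — the transverse spin
correlation length is at most `4β|t| = 4|t|/T` for the whole class. kind: support (PROVED). Why
it might fail: it cannot (proved). Sources: KomaTasakiPRL1992 eq. (1), Theorem eq. (4)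
(one-dimensional clause), eq. (13), p. 3249; this cell bounds.tex Thm 10⁷ (e); tree
`koma_tasaki_magnetic_holds` (`d = 1` conjunct, `W = 0`, rate `1/(16β|t|+1)`) and node
`RingSpinCorrelationLengthLowT` (`W = 0`). -/
@[conjecture] def ClassRingSpinCorrelationLengthLowT : Prop :=
  ∀ (t U μ β : ℝ), 0 ≤ β → 1 ≤ 4 * (β * |t|) →
    ∀ (L : ℕ) [NeZero L] (W : Finset (Orb (FermionTorus 1 L)) → ℝ) (x y : TorusSite 1 L),
      ‖(hubbardTorusWith 1 L t U μ + densityInteraction W).thermalCorr β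
          (siteSpinPlus x) (siteSpinPlus y)ᴴ‖ ≤
        Real.exp (1 / (β * |t|)) * Real.exp (-(1 / (4 * (β * |t|)) * (torusDist x y : ℝ)))

/-- **`ClassRingSpinCorrelationLengthLowT` holds**
(`norm_thermalCorr_siteSpinPlus_ring_densityInteraction_le_exp_lowT`). -/
theorem classRingSpinCorrelationLengthLowT_holds : ClassRingSpinCorrelationLengthLowT :=
  fun t U μ β hβ hT L _ W x y =>
    norm_thermalCorr_siteSpinPlus_ring_densityInteraction_le_exp_lowT L t U μ β hβ hT W x y

/-- **Thm 10⁷ (e), ring, high temperature (PROVED below).** On the ring, if `4β|t| ≤ 1`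
(`T ≥ 4|t|`, including `β = 0` and `t = 0`) then for every `L`, every real `W`, all `x, y`:
`|⟨S⁺_x S⁻_y⟩_{β,L; H+V_W}| ≤ e⁴ exp(-dist(x,y))`. kind: support (PROVED). Why it might fail: it
cannot (proved). Sources: KomaTasakiPRL1992 eq. (1), Theorem eq. (4) (one-dimensional clause);
this cell bounds.tex Thm 10⁷ (e); node `RingSpinCorrelationLengthHighT` (`W = 0`). -/
@[conjecture] def ClassRingSpinCorrelationLengthHighT : Prop :=
  ∀ (t U μ β : ℝ), 0 ≤ β → 4 * (β * |t|) ≤ 1 →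
    ∀ (L : ℕ) [NeZero L] (W : Finset (Orb (FermionTorus 1 L)) → ℝ) (x y : TorusSite 1 L),
      ‖(hubbardTorusWith 1 L t U μ + densityInteraction W).thermalCorr β
          (siteSpinPlus x) (siteSpinPlus y)ᴴ‖ ≤
        Real.exp 4 * Real.exp (-(torusDist x y : ℝ))

/-- **`ClassRingSpinCorrelationLengthHighT` holds**
(`norm_thermalCorr_siteSpinPlus_ring_densityInteraction_le_exp_highT`). -/
theorem classRingSpinCorrelationLengthHighT_holds : ClassRingSpinCorrelationLengthHighT :=
  fun t U μ β hβ hT L _ W x y =>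
    norm_thermalCorr_siteSpinPlus_ring_densityInteraction_le_exp_highT L t U μ β hβ hT W x y

/-! ### Sanity: the member `W = 0` is the plain Hubbard model -/

/-- The member `W = 0` of the class is the plain Hubbard model (`densityInteraction_zero`), so the
class rows specialise to the tree's `W = 0` statements (here: the low-temperature ring row,
cf. node `RingSpinCorrelationLengthLowT`). [folklore] -/
theorem spinRing_lowT_of_class (t U μ β : ℝ) (hβ : 0 ≤ β) (hT : 1 ≤ 4 * (β * |t|)) (L : ℕ)
    [NeZero L] (x y : TorusSite 1 L) :
    ‖(hubbardTorusWith 1 L t U μ).thermalCorr β (siteSpinPlus x) (siteSpinPlus y)ᴴ‖ ≤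
      Real.exp (1 / (β * |t|)) * Real.exp (-(1 / (4 * (β * |t|)) * (torusDist x y : ℝ))) := by
  have h := classRingSpinCorrelationLengthLowT_holds t U μ β hβ hT L (fun _ => (0 : ℝ)) x y
  rw [densityInteraction_zero, add_zero] at h
  exact h

/-- A longitudinal-field instance: for EVERY real field configuration entering through a real
function of the occupations (e.g. `W s = ∑_{u} h_u (𝟙[(u,↑) ∈ s] - 𝟙[(u,↓) ∈ s])/2`, a random or
staggered field `∑_u h_u S^z_u`), the 2D transverse spin correlations obey the `η = 1/4` line with
field-independent `f, C`. This is `classSpinEtaLineEuclid_holds` read for such `W`; stated to make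
the uniformity explicit. [folklore] -/
theorem field_spinEtaLineEuclid (t U μ β : ℝ) (hβ : 0 < β) (hb : β * |t| < 4 / Real.pi) :
    ∃ f C : ℝ, 1 / 4 < f ∧ ∀ (L : ℕ) [NeZero L] (h : FermionTorus 2 L → ℝ) (x y : TorusSite 2 L),
      ‖(hubbardTorusWith 2 L t U μ + densityInteraction (fun s : Finset (Orb (FermionTorus 2 L)) =>
          ∑ u : FermionTorus 2 L, h u * (((if orb u 0 ∈ s then (1 : ℝ) else 0) -
            (if orb u 1 ∈ s then (1 : ℝ) else 0)) / 2))).thermalCorr β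
          (siteSpinPlus x) (siteSpinPlus y)ᴴ‖ ≤
        C * ((torusDist x y : ℝ) + 1) ^ (-f) := by
  obtain ⟨f, C, hf, hC⟩ := classSpinEtaLineEuclid_holds t U μ β hβ hb
  exact ⟨f, C, hf, fun L _ h x y => hC L _ x y⟩

end Summit.HubbardSuperconductivity.HubbardLadder.Bounds

end
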